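import Summits.QuantumFields.BalabanUV.Beta.GAN24.T2SlotUnits
import Summits.QuantumFields.BalabanUV.Beta.GAN24.WSlotOfShapes

/-!
# `BalabanUV.Beta.GAN24.T2SlotOfHW` — binder row G-an2-4 / (CONV-C), the W-slot's located shape «T2Shape» for an2's Stage-B family AS A
# FUNCTION OF the wall's UNIFORM W-row `hW` (constants first): the arrow opposite to leaf-07's `WSlotOfShapes.hW_of_shapes`, hence
# **`hW ↔ «T2Shape»`** given the K-slot, «E3Shape» and the mixed-table shape — the W-slot's uniform half is ONE fixed-point problem

NOT IN PRINT; OUR BOOKKEEPING (G-an2-4 formalisation swarm, idle leaf seat `b2b-balaban-gan24-formalise-leaf-19`, gen 17; module name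
PROVISIONAL — the row owner gan24-p1 / the (P4) author an2 may rename or re-home it).  HONEST FRAMING (cell contract, verbatim): «discharging
`BetaPertH` makes Bałaban's UV stability UNCONDITIONAL — a real constructive-QFT result; it is NOT the continuum limit and NOT the Clay problem.»
HONEST DEPENDENCY (verbatim): «continuum YM on T⁴ ⇐ BetaPertH ∧ nine spine estimates (0/9 proved); BetaPertH ⇐ (D1) ∧ (D4) ∧ CAP+tail;
G-an2-4 gates asym, D1 and NE2/3/4.»  [folklore] packaging: a CONSTANTS-FIRST family form of an2's far-small localisation
`BalabanStepW2.biLoc_K3OfK_far` ⨾ `BalabanStepJetsSucc.biLoc_mmRead` (an2's lemma is existential PER MEMBER — «Existential constant (depending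
on `d, C, Cs, CM, Cw, m` only)» is a docstring remark there, not a Lean statement; here ONE constant serves a whole `ℕ`-indexed family, which
is what `j`-uniformity needs), composed with `GAN24/T2SlotUnits.unitS₂_T2Of_succ_vh₂S` ((T2-REC): the normalised member `j+1` of `T2Of` is
`(cE₂·Lc^{2(d+1)}) •` the value carrier of the NORMALISED step-`j` data `+ cB • mfNeg ∘ vh₂S`), leaf-07's `j`-free multiplier table
`WSlotOfShapes.vertexFamily_unitM_M1` and normalised first field table `WSlotOfShapes.locStencil_unitS_Spure` («E3Shape» in), an3's
`WilsonBiStencil.biLoc_wilsonW₂` (member `0`), an1's `biLoc_vh₂S`.  No estimate is re-proved (an2's bricks `vertexFamily_dM`, `vertexFamily_K2OfK`,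
`biLoc_sandwich`, `biLoc_recenter_left/right`, `biLoc_K3OfK_of_parts`, `biLoc_far_of_pair` BY NAME); no cited fact, no `def`, no `Prop` mirror,
0 sorry.  It asserts NO shape of Bałaban's tables: «T2Shape», «T2SupRate», «T2Drift» stay LOCATED / OPEN; `hW`, `hWall`, the window and the
identification are untouched; K 2/2, S 2/2 wall binders are tree theorems at `d = 3`, `Lc ≥ 2`
(`KSlotAssembly.convCKWall_holds`; `StencilSlotSAllThree.hS_hSall_three`), W 2/2 AT THE DISPLAYED PIN `cE₂ = +Lc^(2(3+1))` at every box root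
(`WSlotT2Tables.hW_hWall_three_an1_pinned`, `WSlotT2TablesAn1.hW_hWall_three_an1At_pinned`) and W 0/2 for the `BetaPertH` wall literal until
(P6)/(R45) — accounting of record ref2 r89 R89-1; THIS module: reduction only, it instantiates none of them; NOT «W-slot closed», NEVER «G-an2-4 closed»; NOT `BetaPertH`, NOT continuum, NOT Clay.

v1.1 DOCFIX (2026-08-20; orphan adoption by the idle leaf seat `b2b-balaban-gan24-formalise-leaf-01` gen 35 — the author lineage
`b2b-balaban-gan24-formalise-leaf-19` is retired): referee-2 objection G-gan24ref2-4 (GAPS.md, round 49; 22 notices through round 89) — the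
module docstring's v1 phrase counting the instantiated wall binders as zero (FALSE since rounds 23/45: the wall's K- and S-pairs ARE tree theorems) is replaced
above by the accounting of record; every declaration of v1 (p210222) is byte-identical, no import change.

THE CIRCLE (census, docstring level — the statements below are its two arrows, nothing more is asserted).  For an2's Stage-B family
`W_j := WbalOf … (T2Of … (vh₂S d Lc) mixFF) mixFF j` in the adopted units:
* leaf-07, `hW_of_shapes`: «T2Shape» at `(C₂, δ₂)` ∧ K-slot at `(C, δ)` ∧ «E3Shape» ∧ mixed shape ⟹ `hW` at rate `m/16`, `m = min δ δs δ₂ δ₄`,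
  constant an2's `CW2 d C Cs CM C₂ CM₂ m` — AFFINE in `C₂`;
* this file, `t2Shape_of_hW`: `hW` at `(Cw, δW)` ∧ K-slot ∧ «E3Shape» ⟹ «T2Shape» at rate `m′/128`, `m′ = min δ δs δW`, constant
  `|cE₂·Lc^{2(d+1)}|·C′ + (border)`, `C′` AFFINE in `Cw` (the sandwich term of `K3OfK`).
So `hW ↔ «T2Shape»` (`hW_iff_t2Shape`), but one turn of the circle maps a rate `m` to at most `m/2048`: the member-by-member induction
`T₂⁽¹⁾(j) ⟹ W⁽¹⁾(j) ⟹ T₂⁽¹⁾(j+1)` that an2's `T2Of_loc` runs with existential constants CANNOT be made `j`-uniform with these bricks — the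
rates degrade geometrically in `j`.  The located obstruction of the W-slot's uniform half is therefore EXACTLY ONE of: a rate-PRESERVING
one-step localisation of the pair `(W2SymOfK, mmRead ∘ K3OfK)` at a FIXED rate (a contraction / fixed-point statement for the affine map of
(T2-REC)), or a CLOSED composite form of the value 4-jet (`T2Of j` = the direct step-`j` 4-jet — the semigroup identity «BCJ has no composite
bi-stencil», `BalabanStepW2` (a)) bounded like PART III's «E3Shape».  Neither is attempted here; both are the owner's / typer's to cut.

## What is proved (generic `d`; `Lc` with `NeZero Lc`, `1 ≤ Lc`)
* §1 constants first: **`biLoc_K3OfK_far_family`** (an2's `biLoc_K3OfK_far` for an `ℕ`-indexed family `(K i, S i, M i, W i)` with common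
  bounds: ONE `C₃ ≥ 0` for all members, rates `m ↦ m/32`), **`locStencil₂_mmRead_K3OfK_family`** (swap-symmetric `VertexFamily₂` second tables
  at rate `m` in, `LocStencil₂` of the value carriers `mmRead Lc ∘ K3OfK …` at ONE constant and rate `m/128` out).
* §2 **`t2Shape_succ_of_hW`** (members `≥ 1`), `locStencil₂_unitS₂_T2Of_zero` (member `0`: `wilsonW₂` + border, any rate `δ ≥ 0`),
  **`t2Shape_of_hW`** (the whole normalised family: `∃ C₂ δ₂, 0 < δ₂ ∧ ∀ j, LocStencil₂ (unitS₂ (sfStep Lc j) (smStep d Lc j) (T2Of … j)) C₂ δ₂`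
  from `UnitDecayK`, «E3Shape» and `hW`).
* §3 **`hW_iff_t2Shape`** — given `UnitDecayK`, «E3Shape» and the mixed binder's `LocStencilFM` shape with field–field support:
  `(∃ Cw δW, 0 < δW ∧ ∀ j, VertexFamily₂ (unitW_j (WbalOf … (T2Of …) … j)) Lc Cw δW) ↔ (∃ C₂ δ₂, 0 < δ₂ ∧ ∀ j, LocStencil₂ (unitS₂_j (T2Of … j)) C₂ δ₂)`.
-/

noncomputable section

open Literature.MathematicalPhysics.QuantumFieldTheory
open Literature.MathematicalPhysics.QuantumFieldTheory.Balaban1983to89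
open Literature.MathematicalPhysics.QuantumFieldTheory.Balaban1983to89.Beta
open B12Sec2to5 (l1 l1_nonneg)
open ExpKernelCalculus (MKer Decays BiLoc VertexFamily VertexFamily₂ comp Zl Zl_nonneg l1_sub_symm biLoc_comp_decays biLoc_comp_biLoc)
open OneStepResolventKernel (Fib LocStencil decays_mono biLoc_mono)
open OneStepKernelFamily (KInvStep)
open StepJetData (mfNeg)
open AveragingHessianKernels (ell)
open BalabanStepJets (locStencil_mono vertexFamily₂_mono)
open BalabanStepJetsSucc (mmRead biLoc_mmRead l1_sub_le_l1_smul_sub wE e3Of)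
open BalabanCompositeJets (LocStencil₂)
open SecondOrderResponse (W2SymOfK LocStencilFM dM K2OfK vertexFamily_dM vertexFamily_K2OfK cdM cK2 cdM_nonneg cK2_nonneg biLoc_sandwich
  biLoc_recenter_left biLoc_recenter_right)
open BalabanStepW2 (Spure M1 M2Of WbalOf K3OfK T2Of WbalOf_swap vertexFamily_mono' biLoc_le_mono biLoc_far_of_pair biLoc_K3OfK_of_parts
  locStencil₂_smul' locStencil₂_add' locStencil₂_mfNeg)
open WilsonBiStencil (wilsonW₂ wBound₂ biLoc_wilsonW₂)
open AveragingMixedJetTables (vh₂S vh2Abs)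
open Summit.QuantumFields.BalabanUV.Beta.HessKerDressedUnits (unitK unitS unitW counitK)
open Summit.QuantumFields.BalabanUV.Beta.SecondOrderUnits (unitM unitS₂ unitM₂)
open Summit.QuantumFields.BalabanUV.Beta.GAN24.CombesThomas (sfStep smStep UnitDecayK)
open Summit.QuantumFields.BalabanUV.Beta.GAN24.WSlotOfShapes (vertexFamily_unitM_M1 locStencil_unitS_Spure hW_of_shapes)
open Summit.QuantumFields.BalabanUV.Beta.GAN24.T2SlotUnits (unitS₂_T2Of_zero unitS₂_T2Of_succ_vh₂S locStencil₂_vh₂S)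

namespace Summit.QuantumFields.BalabanUV.Beta.GAN24.T2SlotOfHW

variable {d : ℕ} {Lc : ℕ} [NeZero Lc]

/-! ## §1 Constants first: an2's far-small localisation of `K3OfK` and the value carrier, for a whole family at once -/

/-- [folklore] **FAMILY FORM OF an2's `biLoc_K3OfK_far`** — adapted from `BalabanStepW2.biLoc_K3OfK_far` (same bricks, same rates): for an
`ℕ`-indexed family of kernels `K i` decaying at `(C, m)`, first tables `S i` / `M i` at `(Cs, m)` / `(CM, m)`, and second tables `W i` bi-localised
at the first bond with the far factor at rate `m` and constant `Cw`, ONE constant `C₃ ≥ 0` (the same polynomial in `card (Fib d), C, cdM, cK2, Cw, Zl`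
as an2's, now quantified BEFORE the member) bi-localises EVERY `K3OfK (K i) Lc (S i) (M i) (W i) b b′` at rate `m/32`, far rate `m/32`. -/
theorem biLoc_K3OfK_far_family {K : ℕ → MKer (d + 1) (Fib d)} {C m : ℝ} (hC : 0 ≤ C) (hm : 0 < m) (hK : ∀ i, Decays (K i) C m)
    {S : ℕ → Fin (d + 1) → (Fin (d + 1) → ℤ) → MKer (d + 1) (Fib d)} {Cs : ℝ} (hS : ∀ i, LocStencil (S i) Cs m)
    {M : ℕ → Fin (d + 1) → (Fin (d + 1) → ℤ) → MKer (d + 1) (Fib d)} {CM : ℝ} (hM : ∀ i, VertexFamily (M i) Lc CM m)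
    {W : ℕ → Fin (d + 1) → (Fin (d + 1) → ℤ) → Fin (d + 1) → (Fin (d + 1) → ℤ) → MKer (d + 1) (Fib d)} {Cw : ℝ} (hCw : 0 ≤ Cw)
    (hW : ∀ i (μ : Fin (d + 1)) (y : Fin (d + 1) → ℤ) (ν : Fin (d + 1)) (y' : Fin (d + 1) → ℤ),
      BiLoc (W i μ y ν y') ((Lc : ℤ) • y) ((Lc : ℤ) • y) (Cw * Real.exp (-m * l1 ((Lc : ℤ) • y' - (Lc : ℤ) • y))) m) :
    ∃ C₃ : ℝ, 0 ≤ C₃ ∧ ∀ i (μ : Fin (d + 1)) (y : Fin (d + 1) → ℤ) (ν : Fin (d + 1)) (y' : Fin (d + 1) → ℤ),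
      BiLoc (K3OfK (K i) Lc (S i) (M i) (W i) μ y ν y') ((Lc : ℤ) • y) ((Lc : ℤ) • y)
        (C₃ * Real.exp (-(m / 32) * l1 ((Lc : ℤ) • y' - (Lc : ℤ) • y))) (m / 32) := by
  have hCs : 0 ≤ Cs := ((hS 0) 0 0).nonneg (Sum.inl 0)
  have hCM : 0 ≤ CM := ((hM 0) 0 0).nonneg (Sum.inl 0)
  have hcdM : 0 ≤ cdM d C Cs CM m := cdM_nonneg hC hCs hCM hm
  have hcK2 : 0 ≤ cK2 d C Cs CM m := cK2_nonneg hC hCs hCM hm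
  have hKm2 : ∀ i, Decays (K i) C (m / 2) := fun i => decays_mono (hK i) hC le_rfl (by linarith)
  -- the product term, generic in the two bonds: centred at (Lc•y, Lc•y'), far factor from `biLoc_comp_biLoc`
  obtain ⟨CP, hCP0, prod⟩ : ∃ CP : ℝ, 0 ≤ CP ∧ ∀ i (μ : Fin (d + 1)) (y : Fin (d + 1) → ℤ) (ν : Fin (d + 1)) (y' : Fin (d + 1) → ℤ),
      BiLoc (comp (comp (K i) (dM (K i) Lc (S i) (M i) μ y)) (K2OfK (K i) Lc (S i) (M i) ν y')) ((Lc : ℤ) • y) ((Lc : ℤ) • y')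
        (CP * Real.exp (-(m / 16) * l1 ((Lc : ℤ) • y - (Lc : ℤ) • y'))) (m / 8) := by
    have hZ1 := Zl_nonneg (D := d + 1) (show 0 < m / 2 - m / 4 by linarith)
    have hZ2 := Zl_nonneg (D := d + 1) (show 0 < m / 16 by positivity)
    refine ⟨(Fintype.card (Fib d) : ℝ) * ((Fintype.card (Fib d) : ℝ) * (C * cdM d C Cs CM m) * Zl (d + 1) (m / 2 - m / 4)
        * cK2 d C Cs CM m) * Zl (d + 1) (m / 16), by positivity, fun i μ y ν y' => ?_⟩
    have hD : BiLoc (dM (K i) Lc (S i) (M i) μ y) ((Lc : ℤ) • y) ((Lc : ℤ) • y) (cdM d C Cs CM m) (m / 2) :=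
      vertexFamily_dM (hK i) hC (hS i) (hM i) hm le_rfl μ y
    have h1 := biLoc_comp_decays (hKm2 i) hD (show (0 : ℝ) ≤ m / 4 by positivity) (by linarith)
    have h1' := biLoc_mono h1 (by positivity) (show m / 8 ≤ m / 4 by linarith)
    have h2 : BiLoc (K2OfK (K i) Lc (S i) (M i) ν y') ((Lc : ℤ) • y') ((Lc : ℤ) • y') (cK2 d C Cs CM m) (m / 8) :=
      vertexFamily_K2OfK (hK i) hC hm (hS i) (hM i) ν y'
    have h3 := biLoc_comp_biLoc h1' h2 (show (0 : ℝ) < m / 8 by positivity)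
    rw [show m / 8 / 2 = m / 16 by ring] at h3
    exact h3
  -- the sandwich term, un-negated, weakened to rate m/32 with far rate m/32
  obtain ⟨CS, hCS0, sand⟩ : ∃ CS : ℝ, 0 ≤ CS ∧ ∀ i (μ : Fin (d + 1)) (y : Fin (d + 1) → ℤ) (ν : Fin (d + 1)) (y' : Fin (d + 1) → ℤ),
      BiLoc (comp (comp (K i) (W i μ y ν y')) (K i)) ((Lc : ℤ) • y) ((Lc : ℤ) • y)
        (CS * Real.exp (-(m / 32) * l1 ((Lc : ℤ) • y' - (Lc : ℤ) • y))) (m / 32) := by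
    have hZ2 := Zl_nonneg (D := d + 1) (show 0 < m / 2 by positivity)
    have hZ4 := Zl_nonneg (D := d + 1) (show 0 < m / 4 by positivity)
    refine ⟨(Fintype.card (Fib d) : ℝ) * ((Fintype.card (Fib d) : ℝ) * (C * Cw) * Zl (d + 1) (m / 2) * C) * Zl (d + 1) (m / 4),
      by positivity, fun i μ y ν y' => ?_⟩
    have h := biLoc_sandwich (hK i) hC hm (hW i μ y ν y')
    have h' : BiLoc (comp (comp (K i) (W i μ y ν y')) (K i)) ((Lc : ℤ) • y) ((Lc : ℤ) • y)
        ((Fintype.card (Fib d) : ℝ) * ((Fintype.card (Fib d) : ℝ) * (C * (Cw * Real.exp (-m * l1 ((Lc : ℤ) • y' - (Lc : ℤ) • y))))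
          * Zl (d + 1) (m / 2) * C) * Zl (d + 1) (m / 4)) (m / 4) := by
      intro x z a b
      have hx := h x z a b
      simp only [abs_neg] at hx
      exact hx
    refine biLoc_le_mono h' (by positivity) ?_ (by linarith)
    have hexp : Real.exp (-m * l1 ((Lc : ℤ) • y' - (Lc : ℤ) • y)) ≤ Real.exp (-(m / 32) * l1 ((Lc : ℤ) • y' - (Lc : ℤ) • y)) :=
      Real.exp_le_exp.2 (by nlinarith [l1_nonneg ((Lc : ℤ) • y' - (Lc : ℤ) • y)])
    have e : (Fintype.card (Fib d) : ℝ) * ((Fintype.card (Fib d) : ℝ) * (C * (Cw * Real.exp (-m * l1 ((Lc : ℤ) • y' - (Lc : ℤ) • y))))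
          * Zl (d + 1) (m / 2) * C) * Zl (d + 1) (m / 4)
        = (Fintype.card (Fib d) : ℝ) * ((Fintype.card (Fib d) : ℝ) * (C * Cw) * Zl (d + 1) (m / 2) * C) * Zl (d + 1) (m / 4)
          * Real.exp (-m * l1 ((Lc : ℤ) • y' - (Lc : ℤ) • y)) := by ring
    rw [e]
    exact mul_le_mul_of_nonneg_left hexp (by positivity)
  refine ⟨CP + CP + CS, by positivity, fun i μ y ν y' => ?_⟩
  -- term A : recentre the second leg from Lc•y' to Lc•y
  have hA : BiLoc (comp (comp (K i) (dM (K i) Lc (S i) (M i) μ y)) (K2OfK (K i) Lc (S i) (M i) ν y')) ((Lc : ℤ) • y) ((Lc : ℤ) • y)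
      (CP * Real.exp (-(m / 32) * l1 ((Lc : ℤ) • y' - (Lc : ℤ) • y))) (m / 32) := by
    have h' : BiLoc (comp (comp (K i) (dM (K i) Lc (S i) (M i) μ y)) (K2OfK (K i) Lc (S i) (M i) ν y')) ((Lc : ℤ) • y) ((Lc : ℤ) • y')
        (CP * Real.exp (-(m / 32) * l1 ((Lc : ℤ) • y' - (Lc : ℤ) • y)) * Real.exp (-(m / 32) * l1 ((Lc : ℤ) • y - (Lc : ℤ) • y')))
        (m / 32) := by
      refine biLoc_le_mono (prod i μ y ν y') (by positivity) ?_ (by linarith)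
      rw [l1_sub_symm ((Lc : ℤ) • y') ((Lc : ℤ) • y), mul_assoc, ← Real.exp_add]
      exact mul_le_mul_of_nonneg_left (Real.exp_le_exp.2 (by nlinarith [l1_nonneg ((Lc : ℤ) • y - (Lc : ℤ) • y')])) hCP0
    exact biLoc_recenter_right h' (by positivity) (by positivity) le_rfl
  -- term B : the swapped product, recentre the first leg from Lc•y' to Lc•y
  have hB : BiLoc (comp (comp (K i) (dM (K i) Lc (S i) (M i) ν y')) (K2OfK (K i) Lc (S i) (M i) μ y)) ((Lc : ℤ) • y) ((Lc : ℤ) • y)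
      (CP * Real.exp (-(m / 32) * l1 ((Lc : ℤ) • y' - (Lc : ℤ) • y))) (m / 32) := by
    have h' : BiLoc (comp (comp (K i) (dM (K i) Lc (S i) (M i) ν y')) (K2OfK (K i) Lc (S i) (M i) μ y)) ((Lc : ℤ) • y') ((Lc : ℤ) • y)
        (CP * Real.exp (-(m / 32) * l1 ((Lc : ℤ) • y' - (Lc : ℤ) • y)) * Real.exp (-(m / 32) * l1 ((Lc : ℤ) • y - (Lc : ℤ) • y')))
        (m / 32) := by
      refine biLoc_le_mono (prod i ν y' μ y) (by positivity) ?_ (by linarith)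
      rw [mul_assoc, ← Real.exp_add, l1_sub_symm ((Lc : ℤ) • y) ((Lc : ℤ) • y')]
      exact mul_le_mul_of_nonneg_left (Real.exp_le_exp.2 (by nlinarith [l1_nonneg ((Lc : ℤ) • y' - (Lc : ℤ) • y)])) hCP0
    exact biLoc_recenter_left h' (by positivity) (by positivity) le_rfl
  have e : CP * Real.exp (-(m / 32) * l1 ((Lc : ℤ) • y' - (Lc : ℤ) • y)) + CP * Real.exp (-(m / 32) * l1 ((Lc : ℤ) • y' - (Lc : ℤ) • y))
      + CS * Real.exp (-(m / 32) * l1 ((Lc : ℤ) • y' - (Lc : ℤ) • y))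
      = (CP + CP + CS) * Real.exp (-(m / 32) * l1 ((Lc : ℤ) • y' - (Lc : ℤ) • y)) := by
    ring
  rw [← e]
  exact biLoc_K3OfK_of_parts hA hB (sand i μ y ν y')

/-- [folklore] **CONSTANTS-FIRST `LocStencil₂` LOCALITY OF THE VALUE CARRIERS OF A FAMILY** (family form of an2's `locStencil₂_e4OfW`): kernels
`K i` at `(C, m)`, first tables at `(Cs, m)` / `(CM, m)`, second tables `W i` that are `(μy)↔(νy′)`-SYMMETRIC `VertexFamily₂` at `(Cw, m)` ⟹ ONE
constant `C′ ≥ 0` with `LocStencil₂ (mmRead Lc ∘ K3OfK (K i) Lc (S i) (M i) (W i)) C′ (m/128)` for EVERY member (pair + swap ⟹ far-small at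
rate `m/4`, `biLoc_far_of_pair`; all data weakened to `m/4`; `biLoc_K3OfK_far_family`; `biLoc_mmRead`). -/
theorem locStencil₂_mmRead_K3OfK_family (hLc : 1 ≤ Lc) {K : ℕ → MKer (d + 1) (Fib d)} {C m : ℝ} (hC : 0 ≤ C) (hm : 0 < m)
    (hK : ∀ i, Decays (K i) C m)
    {S : ℕ → Fin (d + 1) → (Fin (d + 1) → ℤ) → MKer (d + 1) (Fib d)} {Cs : ℝ} (hS : ∀ i, LocStencil (S i) Cs m)
    {M : ℕ → Fin (d + 1) → (Fin (d + 1) → ℤ) → MKer (d + 1) (Fib d)} {CM : ℝ} (hM : ∀ i, VertexFamily (M i) Lc CM m)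
    {W : ℕ → Fin (d + 1) → (Fin (d + 1) → ℤ) → Fin (d + 1) → (Fin (d + 1) → ℤ) → MKer (d + 1) (Fib d)} {Cw : ℝ}
    (hW : ∀ i, VertexFamily₂ (W i) Lc Cw m) (hWs : ∀ i μ y ν y', W i ν y' μ y = W i μ y ν y') :
    ∃ C' : ℝ, 0 ≤ C' ∧ ∀ i, LocStencil₂ (fun κ u κ' u' => mmRead Lc (K3OfK (K i) Lc (S i) (M i) (W i) κ u κ' u')) C' (m / 128) := by
  have hCs : 0 ≤ Cs := ((hS 0) 0 0).nonneg (Sum.inl 0)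
  have hCM : 0 ≤ CM := ((hM 0) 0 0).nonneg (Sum.inl 0)
  have hCw : 0 ≤ Cw := ((hW 0) 0 0 0 0).nonneg (Sum.inl 0)
  have hm4 : 0 < m / 4 := by positivity
  have hK' : ∀ i, Decays (K i) C (m / 4) := fun i => decays_mono (hK i) hC le_rfl (by linarith)
  have hS' : ∀ i, LocStencil (S i) Cs (m / 4) := fun i => locStencil_mono (hS i) hCs (by linarith)
  have hM' : ∀ i, VertexFamily (M i) Lc CM (m / 4) := fun i => vertexFamily_mono' (hM i) hCM (by linarith)
  have hWfar : ∀ i (μ : Fin (d + 1)) (y : Fin (d + 1) → ℤ) (ν : Fin (d + 1)) (y' : Fin (d + 1) → ℤ),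
      BiLoc (W i μ y ν y') ((Lc : ℤ) • y) ((Lc : ℤ) • y) (Cw * Real.exp (-(m / 4) * l1 ((Lc : ℤ) • y' - (Lc : ℤ) • y))) (m / 4) := by
    intro i μ y ν y'
    have h2 : BiLoc (W i μ y ν y') ((Lc : ℤ) • y') ((Lc : ℤ) • y) Cw m := by
      rw [← hWs i μ y ν y']
      exact hW i ν y' μ y
    refine biLoc_le_mono (biLoc_far_of_pair (hW i μ y ν y') h2 hm.le) (by positivity) ?_ le_rfl
    exact mul_le_mul_of_nonneg_left (Real.exp_le_exp.2 (by nlinarith [l1_nonneg ((Lc : ℤ) • y' - (Lc : ℤ) • y)])) hCw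
  obtain ⟨C₃, hC₃, h3⟩ := biLoc_K3OfK_far_family (Lc := Lc) hC hm4 hK' hS' hM' hCw hWfar
  refine ⟨C₃, hC₃, fun i κ u κ' u' => ?_⟩
  have h' : BiLoc (K3OfK (K i) Lc (S i) (M i) (W i) κ u κ' u') ((Lc : ℤ) • u) ((Lc : ℤ) • u)
      (C₃ * Real.exp (-(m / 128) * l1 (u' - u))) (m / 128) := by
    refine biLoc_le_mono (h3 i κ u κ' u') (by positivity) ?_ (by linarith)
    rw [show m / 4 / 32 = m / 128 by ring]
    exact mul_le_mul_of_nonneg_left (Real.exp_le_exp.2 (by nlinarith [l1_sub_le_l1_smul_sub hLc u' u, hC₃])) hC₃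
  exact biLoc_mmRead hLc h' (by positivity)

/-! ## §2 «T2Shape» for an2's Stage-B family from the K-slot, «E3Shape» and the wall's uniform W-row `hW` -/

/-- [folklore] The normalised second-order family inherits the swap symmetry of `WbalOf` (`unitW` conjugates entrywise). -/
theorem unitW_WbalOf_swap (sf sm cE cVH cΛ : ℝ)
    (T₂ : ℕ → Fin (d + 1) → (Fin (d + 1) → ℤ) → Fin (d + 1) → (Fin (d + 1) → ℤ) → MKer (d + 1) (Fib d))
    (mixFF : Fin (d + 1) → (Fin (d + 1) → ℤ) → Fin (d + 1) → (Fin (d + 1) → ℤ) → MKer (d + 1) (Fib d)) (j : ℕ)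
    (μ : Fin (d + 1)) (y : Fin (d + 1) → ℤ) (ν : Fin (d + 1)) (y' : Fin (d + 1) → ℤ) :
    unitW sf sm (WbalOf d Lc cE cVH cΛ T₂ mixFF j) ν y' μ y = unitW sf sm (WbalOf d Lc cE cVH cΛ T₂ mixFF j) μ y ν y' := by
  show counitK sf sm (WbalOf d Lc cE cVH cΛ T₂ mixFF j ν y' μ y) = counitK sf sm (WbalOf d Lc cE cVH cΛ T₂ mixFF j μ y ν y')
  rw [WbalOf_swap]

/-- **«T2Shape» FOR THE MEMBERS `≥ 1` OF an2's STAGE-B FAMILY, AS A FUNCTION OF THE WALL'S UNIFORM W-ROW** [folklore packaging]: from the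
K-slot's decay half `UnitDecayK d Lc (sfStep Lc) (smStep d Lc) C δ`, «E3Shape» (`hE3`, leaf-07's byte shape), and the wall's UNIFORM second-order
binder `hW` for the family `W := WbalOf … (T2Of … (vh₂S d Lc) mixFF) mixFF` in the adopted units (LITERALLY the conclusion of leaf-07's
`WSlotOfShapes.hW_of_shapes` / the hypothesis `hW` of `HessKerDressedUnitsWall.d1Drift_JsBalOf_iff_of_cauchy_unit` for this family):
`∃ C₂ δ₂, 0 < δ₂ ∧ ∀ j, LocStencil₂ (unitS₂ (sfStep Lc (j+1)) (smStep d Lc (j+1)) (T2Of … (j+1))) C₂ δ₂` — route (T2-REC)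
`T2SlotUnits.unitS₂_T2Of_succ_vh₂S` + `locStencil₂_mmRead_K3OfK_family` at the common rate `m = min δ δs δW` (rate out `m/128`) + the `j`-free
border `T2SlotUnits.locStencil₂_vh₂S`.  No binder table hypothesis on `mixFF` is needed in this direction (it sits inside `hW`). -/
theorem t2Shape_succ_of_hW (hLc : 1 ≤ Lc) {C δ : ℝ} (hK : UnitDecayK d Lc (sfStep Lc) (smStep d Lc) C δ) (hδ : 0 < δ)
    {cE cVH cΛ C₃ δ₃ : ℝ}
    (hE3 : ∀ j : ℕ, LocStencil (unitS (sfStep Lc (j + 1)) (smStep d Lc (j + 1))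
      (fun κ u => (cE * wE d Lc (j + 1)) • e3Of d Lc cE cVH cΛ (j + 1) κ u)) C₃ δ₃) (hδ₃ : 0 < δ₃)
    (cE₂ cB : ℝ) (T : Fin 4 → Fin 4 → Fin 4 → Fin 4 → ℝ)
    (mixFF : Fin (d + 1) → (Fin (d + 1) → ℤ) → Fin (d + 1) → (Fin (d + 1) → ℤ) → MKer (d + 1) (Fib d)) {Cw δW : ℝ}
    (hW : ∀ j, VertexFamily₂ (unitW (sfStep Lc j) (smStep d Lc j)
      (WbalOf d Lc cE cVH cΛ (T2Of d Lc cE cVH cΛ cE₂ cB T (vh₂S d Lc) mixFF) mixFF j)) Lc Cw δW) (hδW : 0 < δW) :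
    ∃ C₂ δ₂ : ℝ, 0 < δ₂ ∧ ∀ j, LocStencil₂ (unitS₂ (sfStep Lc (j + 1)) (smStep d Lc (j + 1))
      (T2Of d Lc cE cVH cΛ cE₂ cB T (vh₂S d Lc) mixFF (j + 1))) C₂ δ₂ := by
  obtain ⟨Cs, δs, hδs, hS⟩ := locStencil_unitS_Spure (d := d) (Lc := Lc) hLc hE3 hδ₃
  have hC : 0 ≤ C := (hK 0).nonneg (Sum.inl 0)
  have hCs : 0 ≤ Cs := ((hS 0) 0 0).nonneg (Sum.inl 0)
  have hCw : 0 ≤ Cw := ((hW 0) 0 0 0 0).nonneg (Sum.inl 0)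
  -- the common rate
  set m : ℝ := min (min δ δs) δW with hm_def
  have hm0 : 0 < m := lt_min (lt_min hδ hδs) hδW
  have hmW : m ≤ δW := min_le_right _ _
  have hms : m ≤ δs := (min_le_left _ _).trans (min_le_right _ _)
  have hmK : m ≤ δ := (min_le_left _ _).trans (min_le_left _ _)
  -- the `j`-free multiplier-table constant at the common rate (leaf-07)
  set CM : ℝ := |cΛ| * (2 * (ell (d + 1) Lc : ℝ) ^ 2 * Real.exp (4 * ((d : ℝ) + 1) * Lc * m)) with hCM_def
  have hK' : ∀ j, Decays (unitK (sfStep Lc j) (smStep d Lc j) (KInvStep (d := d) Lc j)) C m :=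
    fun j => decays_mono (hK j) hC le_rfl hmK
  have hS' : ∀ j, LocStencil (unitS (sfStep Lc j) (smStep d Lc j) (Spure d Lc cE cVH cΛ j)) Cs m :=
    fun j => locStencil_mono (hS j) hCs hms
  have hM' : ∀ j, VertexFamily (unitM (sfStep Lc j) (smStep d Lc j) (M1 d Lc cΛ j)) Lc CM m :=
    fun j => vertexFamily_unitM_M1 hLc cΛ hm0.le j
  have hW' : ∀ j, VertexFamily₂ (unitW (sfStep Lc j) (smStep d Lc j)
      (WbalOf d Lc cE cVH cΛ (T2Of d Lc cE cVH cΛ cE₂ cB T (vh₂S d Lc) mixFF) mixFF j)) Lc Cw m :=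
    fun j => vertexFamily₂_mono (hW j) hCw hmW
  obtain ⟨C', hC', hval⟩ := locStencil₂_mmRead_K3OfK_family (Lc := Lc) hLc hC hm0 hK' hS' hM' hW'
    (fun j μ y ν y' => unitW_WbalOf_swap (sfStep Lc j) (smStep d Lc j) cE cVH cΛ _ mixFF j μ y ν y')
  have hm128 : (0 : ℝ) ≤ m / 128 := by positivity
  refine ⟨|cE₂ * (Lc : ℝ) ^ (2 * (d + 1))| * C' +
      |cB| * (vh2Abs (0 : Fin (d + 1) → ℤ) Lc * Real.exp (6 * ((d : ℝ) + 1) * Lc * (m / 128))), m / 128, by positivity, fun j => ?_⟩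
  rw [unitS₂_T2Of_succ_vh₂S]
  exact locStencil₂_add' (locStencil₂_smul' _ (hval j)) (locStencil₂_smul' cB (locStencil₂_mfNeg (locStencil₂_vh₂S hLc hm128)))

/-- [folklore] **MEMBER `0` IN UNITS IS A `LocStencil₂` FAMILY AT ANY RATE `δ ≥ 0`** (an3's `biLoc_wilsonW₂` + an1's border): constant
`|cE₂|·wBound₂·e^{8δ} + |cB|·vh2Abs·e^{6(d+1)Lc·δ}`. -/
theorem locStencil₂_unitS₂_T2Of_zero (hLc : 1 ≤ Lc) (cE cVH cΛ cE₂ cB : ℝ) (T : Fin 4 → Fin 4 → Fin 4 → Fin 4 → ℝ)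
    (mixFF : Fin (d + 1) → (Fin (d + 1) → ℤ) → Fin (d + 1) → (Fin (d + 1) → ℤ) → MKer (d + 1) (Fib d)) {δ : ℝ} (hδ : 0 ≤ δ) :
    LocStencil₂ (unitS₂ (sfStep Lc 0) (smStep d Lc 0) (T2Of d Lc cE cVH cΛ cE₂ cB T (vh₂S d Lc) mixFF 0))
      (|cE₂| * (wBound₂ d T * Real.exp (8 * δ)) + |cB| * (vh2Abs (0 : Fin (d + 1) → ℤ) Lc * Real.exp (6 * ((d : ℝ) + 1) * Lc * δ))) δ := by
  rw [unitS₂_T2Of_zero]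
  have hWil : LocStencil₂ (wilsonW₂ d T) (wBound₂ d T * Real.exp (8 * δ)) δ := fun κ u κ' u' => biLoc_wilsonW₂ T hδ κ u κ' u'
  exact locStencil₂_add' (locStencil₂_smul' cE₂ hWil) (locStencil₂_smul' cB (locStencil₂_mfNeg (locStencil₂_vh₂S hLc hδ)))

/-- **«T2Shape» FOR an2's STAGE-B FAMILY ⇐ K-SLOT ∧ «E3Shape» ∧ THE WALL'S UNIFORM W-ROW** [folklore packaging]: the whole normalised family
`j ↦ unitS₂ (sfStep Lc j) (smStep d Lc j) (T2Of … (vh₂S d Lc) mixFF j)` is a `LocStencil₂` family with ONE constant and ONE positive rate —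
LITERALLY the hypothesis `hT₂` of leaf-07's `WSlotOfShapes.hW_of_shapes` at `T₂ := T2Of … (vh₂S d Lc) mixFF` — from `UnitDecayK`, «E3Shape»
and `hW` (member `0` by `locStencil₂_unitS₂_T2Of_zero`, members `≥ 1` by `t2Shape_succ_of_hW`). -/
theorem t2Shape_of_hW (hLc : 1 ≤ Lc) {C δ : ℝ} (hK : UnitDecayK d Lc (sfStep Lc) (smStep d Lc) C δ) (hδ : 0 < δ)
    {cE cVH cΛ C₃ δ₃ : ℝ}
    (hE3 : ∀ j : ℕ, LocStencil (unitS (sfStep Lc (j + 1)) (smStep d Lc (j + 1))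
      (fun κ u => (cE * wE d Lc (j + 1)) • e3Of d Lc cE cVH cΛ (j + 1) κ u)) C₃ δ₃) (hδ₃ : 0 < δ₃)
    (cE₂ cB : ℝ) (T : Fin 4 → Fin 4 → Fin 4 → Fin 4 → ℝ)
    (mixFF : Fin (d + 1) → (Fin (d + 1) → ℤ) → Fin (d + 1) → (Fin (d + 1) → ℤ) → MKer (d + 1) (Fib d)) {Cw δW : ℝ}
    (hW : ∀ j, VertexFamily₂ (unitW (sfStep Lc j) (smStep d Lc j)
      (WbalOf d Lc cE cVH cΛ (T2Of d Lc cE cVH cΛ cE₂ cB T (vh₂S d Lc) mixFF) mixFF j)) Lc Cw δW) (hδW : 0 < δW) :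
    ∃ C₂ δ₂ : ℝ, 0 < δ₂ ∧ ∀ j, LocStencil₂ (unitS₂ (sfStep Lc j) (smStep d Lc j)
      (T2Of d Lc cE cVH cΛ cE₂ cB T (vh₂S d Lc) mixFF j)) C₂ δ₂ := by
  obtain ⟨C₁, δ₁, hδ₁, hsucc⟩ := t2Shape_succ_of_hW hLc hK hδ hE3 hδ₃ cE₂ cB T mixFF hW hδW
  have h0 := locStencil₂_unitS₂_T2Of_zero (d := d) (Lc := Lc) hLc cE cVH cΛ cE₂ cB T mixFF hδ₁.le
  set C₀ : ℝ := |cE₂| * (wBound₂ d T * Real.exp (8 * δ₁)) +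
    |cB| * (vh2Abs (0 : Fin (d + 1) → ℤ) Lc * Real.exp (6 * ((d : ℝ) + 1) * Lc * δ₁)) with hC₀_def
  have hC₀ : 0 ≤ C₀ := by
    have := (h0 0 0 0 0).nonneg (Sum.inl 0)
    have h1 : (0 : ℝ) < Real.exp (-δ₁ * l1 ((0 : Fin (d + 1) → ℤ) - 0)) := Real.exp_pos _
    nlinarith
  have hC₁ : 0 ≤ C₁ := by
    have := ((hsucc 0) 0 0 0 0).nonneg (Sum.inl 0)
    have h1 : (0 : ℝ) < Real.exp (-δ₁ * l1 ((0 : Fin (d + 1) → ℤ) - 0)) := Real.exp_pos _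
    nlinarith
  refine ⟨max C₀ C₁, δ₁, hδ₁, fun j => ?_⟩
  cases j with
  | zero =>
    exact fun κ u κ' u' => biLoc_le_mono (h0 κ u κ' u') (by positivity)
      (mul_le_mul_of_nonneg_right (le_max_left _ _) (Real.exp_pos _).le) le_rfl
  | succ j =>
    exact fun κ u κ' u' => biLoc_le_mono (hsucc j κ u κ' u') (by positivity)
      (mul_le_mul_of_nonneg_right (le_max_right _ _) (Real.exp_pos _).le) le_rfl

/-! ## §3 The circle: `hW ↔ «T2Shape»` for an2's Stage-B family -/

/-- **THE W-SLOT's UNIFORM HALF IS ONE FIXED-POINT PROBLEM** [folklore assembly]: given the K-slot's decay half, «E3Shape» and the mixed binder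
table's `LocStencilFM` shape with field–field support (leaf-07's hypotheses), the wall's UNIFORM second-order binder `hW` for an2's Stage-B
family `WbalOf … (T2Of … (vh₂S d Lc) mixFF) mixFF` in the adopted units and the located shape «T2Shape» of the normalised recursive bi-stencil
family ARE EQUIVALENT: `→` is `t2Shape_of_hW` (rate `min δ δs δW / 128`), `←` is leaf-07's `WSlotOfShapes.hW_of_shapes` (rate
`min δ δs δ₂ δ₄ / 16`).  One turn of the circle therefore costs a factor `≥ 2048` in the rate: the member-by-member induction of an2's
`T2Of_loc` cannot be made `j`-uniform with these bricks — the located obstruction named in the module docstring.  Nothing of `hW` or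
«T2Shape» is asserted. -/
theorem hW_iff_t2Shape (hLc : 1 ≤ Lc) {C δ : ℝ} (hK : UnitDecayK d Lc (sfStep Lc) (smStep d Lc) C δ) (hδ : 0 < δ)
    {cE cVH cΛ C₃ δ₃ : ℝ}
    (hE3 : ∀ j : ℕ, LocStencil (unitS (sfStep Lc (j + 1)) (smStep d Lc (j + 1))
      (fun κ u => (cE * wE d Lc (j + 1)) • e3Of d Lc cE cVH cΛ (j + 1) κ u)) C₃ δ₃) (hδ₃ : 0 < δ₃)
    (cE₂ cB : ℝ) (T : Fin 4 → Fin 4 → Fin 4 → Fin 4 → ℝ)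
    {mixFF : Fin (d + 1) → (Fin (d + 1) → ℤ) → Fin (d + 1) → (Fin (d + 1) → ℤ) → MKer (d + 1) (Fib d)} {CM₂ δ₄ : ℝ}
    (hmix : LocStencilFM Lc mixFF CM₂ δ₄) (hδ₄ : 0 < δ₄)
    (hfm : ∀ κ u ρ w x z (α μ' : Fin (d + 1)), mixFF κ u ρ w x z (Sum.inl α) (Sum.inr μ') = 0)
    (hm : ∀ κ u ρ w x z (μ' : Fin (d + 1)) (b : Fib d), mixFF κ u ρ w x z (Sum.inr μ') b = 0) :
    (∃ Cw δW : ℝ, 0 < δW ∧ ∀ j, VertexFamily₂ (unitW (sfStep Lc j) (smStep d Lc j)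
        (WbalOf d Lc cE cVH cΛ (T2Of d Lc cE cVH cΛ cE₂ cB T (vh₂S d Lc) mixFF) mixFF j)) Lc Cw δW) ↔
      (∃ C₂ δ₂ : ℝ, 0 < δ₂ ∧ ∀ j, LocStencil₂ (unitS₂ (sfStep Lc j) (smStep d Lc j)
        (T2Of d Lc cE cVH cΛ cE₂ cB T (vh₂S d Lc) mixFF j)) C₂ δ₂) := by
  constructor
  · rintro ⟨Cw, δW, hδW, hW⟩
    exact t2Shape_of_hW hLc hK hδ hE3 hδ₃ cE₂ cB T mixFF hW hδW
  · rintro ⟨C₂, δ₂, hδ₂, hT₂⟩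
    exact hW_of_shapes hLc hK hδ hE3 hδ₃ hT₂ hδ₂ hmix hδ₄ hfm hm

end Summit.QuantumFields.BalabanUV.Beta.GAN24.T2SlotOfHW

end
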